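import Literature.MathematicalPhysics.QuantumFieldTheory.Balaban1983to89.Node00.SmallFieldChi29OfRecord
import Literature.MathematicalPhysics.QuantumFieldTheory.Balaban1983to89.Node00.BackgroundSelOfRecord
import Literature.MathematicalPhysics.QuantumFieldTheory.Balaban1983to89.BlockAxialRepresentative

/-!
# NODE 00 — THE BLOCK-AXIAL CRITICAL CONFIGURATION AT THE RECORD ([Balaban1987RG1] (2.2)–(2.3) p. 265): the axialised k-fold average
# `axialize cd (critCfgOfRecord …)` is INDEPENDENT of the minimiser chosen, satisfies `G = 0`, and is block-lift covariant on the [B11] domain;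
# the (2.9) deviation centred at it is lift-invariant there — the theorems the CHOICE-CHANNEL repair (R-C) needs, stated WITHOUT re-pointing any name

CITATION HEADER.  [Balaban1987RG1] = T. Bałaban, CMP **109** (1987) 249–301 (= [I]; held `paper:balaban1987-cmp109-rg-i-small-field`, journal page = PDF
page + 248), p. 265 L19–27: *"there exists the exactly one critical point, which is obtained by taking the critical orbit of the function A(U_k(V)) … and
choosing the element of the orbit satisfying the axial gauge conditions G(V) = 0. This critical configuration … V^{(k)} = V^{(k)}(W) … V^{(k)} = M^k(U_{k+1}).
(2.3)"*; p. 266 (2.5) *"G(VV^{(k)}) = G(V′)"*; (2.9) p. 266 the cut-off `χ_k = Π_b χ({|B′(b)| < ε₁})`, `V = exp(iB′)V^{(k)}`; (2.16) p. 269 gauge invariance.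
[Balaban1985Variational] = [B11] (CMP 102) Thm 1 p. 279, (181) p. 307 *"U_k(V^v) = U_k(V)^{v̄}"*.

WHY (cell `ym-nodeO-ideate` ∕ `ym-balaban-port`, porter seat `ymgap-nodeO-port-PTA-2`; located reading «CHOICE CHANNEL» on `stmt-QuantumFields-27930`,
director-ym №460 docket Q-3, body-freeze (2)).  The record's critical configuration `Node00.critCfgOfRecord ν K k W = Ū^k(Uk … (k+1) … W)` is the k-fold
average of the BARE-CHOICE minimiser `Uk := Classical.choose …` (no gauge normalisation), so it — and the (2.9) cut-off `chiFix29OfRecord` centred at it —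
depend on which point of the residual orbit the choice returns, while the absolute gauge fixing `gfOfRecord` is centred at the block-axial element.  The
explicit block-axialiser of `BlockAxialRepresentative` (✓ this seat) composed with `critCfgOfRecord` is the cure; THIS FILE proves, AT THE RECORD'S OWN
OBJECTS and for ANY contour datum `cd` on `T^{(k)}` (instantiate `cd := contourOfRecord F N K k`), everything a type owner needs to adopt it as a NEW name
(`critCfgAxOfRecord := axialize cd ∘ critCfgOfRecord`, def-T ∕ K0e lane — NOT defined here, per the freeze: no body of record is touched):
* §1 `toMS_emb_of_isResidual`, `axialize_iter_eq_of_orbitRel` — two fine fields in one residual orbit of level `k+1` have k-fold averages that differ by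
  a gauge transformation trivial at the block centres, hence the SAME axialised average.
* §2 ★ `axialize_critCfgOfRecord_eq_of_isBackground` — CHOICE-FREENESS: on the [B11] domain (`UniqueUkOrbit`), the axialised critical configuration of
  record equals the axialised k-average of ANY minimiser; ★ `gaugeFixFn_axialize_critCfgOfRecord` — print's normalisation `G(V^{(k)}) = 0` (whence (2.5)).
* §3 ★ `axialize_critCfgOfRecord_gaugeAct` — BLOCK-LIFT COVARIANCE `V^{(k)}_{ax}(W^v) = (V^{(k)}_{ax}(W))^{v∘blockOf}` on the [B11] domain (from
  `isBackground_gaugeAct_toMS'`: the lifted minimiser is a minimiser over `W^v`; [B11] (181)'s content for the AXIALISED selection — a theorem here, a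
  hypothesis (`hcov`) for the bare choice in `Summits/…/BalabanUVNodesN09LiftInvariance29AtRecord`).
* §4 ★ `dist1_axialCentre_gaugeAct_liftTransf` — the (2.9) fluctuation deviation CENTRED AT THE AXIAL REPRESENTATIVE, `|V^{(k)}_{ax}(V̄)(b)⁻¹V(b) − 1|`, is
  invariant under the block-constant lifts at every `V` whose average lies in the [B11] domain — so a (2.9) cut-off centred there is lift-invariant on the
  domain (N09's (M1) for the repaired χ), with NO covariance hypothesis.
HONEST FRAMING.  Gauge algebra + the tree's [B11]-shaped hypotheses `UkExists`∕`UniqueUkOrbit` (never asserted); nothing of Bałaban's estimates; no name of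
record re-pointed (theorems about the composed term only); no `sorry`, no `def`, no `instance`; standard axioms; the YM mass gap (Clay) is NOT proved by any of this.
-/

noncomputable section

namespace Literature.MathematicalPhysics.QuantumFieldTheory.Balaban1983to89.Node00

open T4Continuum (T4Family)
open B12GaugeOrbits021 (OrbitRel IsResidual)
open B15Eq177GaugeInvariance (blockLift toMS_blockLift_self)
open B16Sect1Backgrounds (toMS iter_gaugeAct)
open B12RTGaugeInvariance254 (liftTransf avg_gaugeAct_liftTransf)
open BlockAxialRepresentative (axialize axialize_gaugeAct_of_central axialize_gaugeAct_liftTransf gaugeFixFn_axialize)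
open GaugeField (gaugeAct)

variable {F : T4Family} {N : ℕ} [NeZero N]

/-! ## §1. Residual orbits of level `k+1` have k-fold averages in one «central» class -/

/-- A residual gauge transformation of level `k + 1` (trivial at the sites of `T^{(k+1)}`), restricted to `T^{(k)}`, is trivial AT THE BLOCK CENTRES
`emb y` (and free elsewhere) — `embIter (k+1) y = embIter k (emb y)` definitionally. [cite: Balaban1987RG1, (0.21) p.256 (bookkeeping)] -/
theorem toMS_emb_of_isResidual {K k : ℕ} {u : GaugeTransf (F.P K) 0 (SU N)} (hu : IsResidual (k + 1) u) (y : Site (F.P K) (k + 1)) :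
    toMS u k (emb y) = 1 :=
  hu y

/-- **Two fine fields in one residual orbit of level `k + 1` have the same AXIALISED k-fold average** (their averages differ by the central transformation
`u↾T^{(k)}`, `iter_gaugeAct`, which the axialiser does not see, `axialize_gaugeAct_of_central`). [cite: Balaban1987RG1, (2.3) p.265, (0.21) p.256] -/
theorem axialize_iter_eq_of_orbitRel {K k : ℕ} (hk : k ≤ (F.P K).m + (F.P K).K) (cd : ContourData (F.P K) k (SU N))
    {U₀ U₀' : GaugeField (F.P K) 0 (SU N)} (h : OrbitRel (k + 1) U₀ U₀') :
    axialize cd (Averaging.iter (avOfRecord F N K) k U₀') = axialize cd (Averaging.iter (avOfRecord F N K) k U₀) := by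
  obtain ⟨u, hu, rfl⟩ := h
  rw [iter_gaugeAct (avOfRecord F N K) u U₀ k hk]
  exact axialize_gaugeAct_of_central cd _ (toMS_emb_of_isResidual hu)

/-! ## §2. Choice-freeness of the axialised critical configuration of record, and `G(V^{(k)}) = 0` -/

/-- **★ CHOICE-FREENESS** — on the [B11] domain (one minimal orbit, `UniqueUkOrbit`), the axialised critical configuration of record `axialize cd (V^{(k)}(W))`,
`V^{(k)}(W) = Ū^k(Uk … W)` with `Uk` the BARE `Classical.choose`, equals the axialised k-fold average of ANY minimiser `U₀` over `W`: it does not depend on the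
choice (print's «the exactly one critical point», (2.3)). [cite: Balaban1987RG1, (2.2)–(2.3) p.265; Balaban1985Variational, Thm 1 p.279] -/
theorem axialize_critCfgOfRecord_eq_of_isBackground {ν : Stage7Numerics} {K k : ℕ} (hk : k ≤ (F.P K).m + (F.P K).K)
    (cd : ContourData (F.P K) k (SU N)) {W : GaugeField (F.P K) (k + 1) (SU N)} (huniq : UniqueUkOrbit F N K (k + 1) ν.εreg W)
    {U₀ : GaugeField (F.P K) 0 (SU N)} (hU₀ : IsBackground (avOfRecord F N K) (bgReg F N K (k + 1) ν.εreg) (k + 1) W U₀) :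
    axialize cd (critCfgOfRecord F N ν K k W) = axialize cd (Averaging.iter (avOfRecord F N K) k U₀) := by
  rw [critCfgOfRecord_def]
  exact axialize_iter_eq_of_orbitRel hk cd (huniq _ _ hU₀ (isBackground_Uk ⟨U₀, hU₀⟩))

/-- **★ `G(Y, V^{(k)}_{ax}) = 0`** — print's normalisation of (2.3) holds for the axialised critical configuration of record, every block family `Y`
(so (2.5) «G(VV^{(k)}) = G(V′)» becomes available at the record). [cite: Balaban1987RG1, p.265 L21–23 and (2.5) p.266] -/
theorem gaugeFixFn_axialize_critCfgOfRecord {ν : Stage7Numerics} {K k : ℕ} (hk : k + 1 ≤ (F.P K).m + (F.P K).K)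
    (cd : ContourData (F.P K) k (SU N)) (W : GaugeField (F.P K) (k + 1) (SU N)) (Y : Finset (Site (F.P K) (k + 1))) :
    gaugeFixFn cd Y (axialize cd (critCfgOfRecord F N ν K k W)) = 0 :=
  gaugeFixFn_axialize hk cd _ Y

/-! ## §3. Block-lift covariance on the [B11] domain -/

/-- **★ BLOCK-LIFT COVARIANCE OF THE AXIALISED CRITICAL CONFIGURATION** — for `W` in the [B11] domain (solvable at `W`, one minimal orbit at `W^v`):
`axialize cd (V^{(k)}(W^v)) = (axialize cd (V^{(k)}(W)))^{v∘blockOf}`.  Proof: the block lift `(Uk W)^{blockLift (k+1) v}` IS a minimiser over `W^v`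
(`isBackground_gaugeAct_toMS'`), so by §2 the left side is the axialised average of it, `= axialize cd ((V^{(k)}(W))^{liftTransf v})` (`iter_gaugeAct`,
`toMS_blockLift_succ'`) `= (axialize cd (V^{(k)}(W)))^{liftTransf v}` (`axialize_gaugeAct_liftTransf`).  [B11] (181) for the axialised selection, as a theorem.
[cite: Balaban1987RG1, (2.3) p.265, (2.16) p.269; Balaban1985Variational, (181) p.307] -/
theorem axialize_critCfgOfRecord_gaugeAct {ν : Stage7Numerics} {K k : ℕ} (hk : k + 1 ≤ (F.P K).m + (F.P K).K)
    (cd : ContourData (F.P K) k (SU N)) (v : GaugeTransf (F.P K) (k + 1) (SU N)) {W : GaugeField (F.P K) (k + 1) (SU N)}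
    (hex : UkExists F N K (k + 1) ν.εreg W) (huniq : UniqueUkOrbit F N K (k + 1) ν.εreg (gaugeAct v W)) :
    axialize cd (critCfgOfRecord F N ν K k (gaugeAct v W)) = gaugeAct (liftTransf v) (axialize cd (critCfgOfRecord F N ν K k W)) := by
  have hk' : k ≤ (F.P K).m + (F.P K).K := Nat.le_of_succ_le hk
  have hB := isBackground_gaugeAct_toMS' (ε := ν.εreg) hk (isBackground_Uk hex) (blockLift (k + 1) v)
  rw [toMS_blockLift_self hk] at hB
  rw [axialize_critCfgOfRecord_eq_of_isBackground hk' cd huniq hB, iter_gaugeAct (avOfRecord F N K) _ _ k hk', toMS_blockLift_succ' hk' v,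
    ← critCfgOfRecord_def, axialize_gaugeAct_liftTransf hk]

/-! ## §4. The (2.9) deviation centred at the axial representative is lift-invariant on the [B11] domain -/

/-- **★ THE AXIAL-CENTRED FLUCTUATION DEVIATION IS LIFT-INVARIANT** — for `V` on `T^{(k)}` with `V̄` in the [B11] domain, every coarse `v` and every bond `b`:
`|V^{(k)}_{ax}(V̄^{v})(b)⁻¹ · (V^{v∘blockOf})(b) − 1| = |V^{(k)}_{ax}(V̄)(b)⁻¹ · V(b) − 1|` ([I] p. 265 «the expressions in (2.1) are invariant»; `V̄^v = (V^{v∘B})‾`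
by `avg_gaugeAct_liftTransf`, §3, and conjugation invariance of `dist1`).  Hence a (2.9) cut-off CENTRED AT `axialize cd (V^{(k)}(·))` is invariant under the
lifted coarse gauge transformations over the domain — N09's (M1) for the repaired cut-off, hypothesis-free. [cite: Balaban1987RG1, (2.1) p.265, (2.9) p.266, (2.16) p.269] -/
theorem dist1_axialCentre_gaugeAct_liftTransf {ν : Stage7Numerics} {K k : ℕ} (hk : k + 1 ≤ (F.P K).m + (F.P K).K)
    (cd : ContourData (F.P K) k (SU N)) (v : GaugeTransf (F.P K) (k + 1) (SU N)) (V : GaugeField (F.P K) k (SU N))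
    (hex : UkExists F N K (k + 1) ν.εreg ((avOfRecord F N K k).avg V))
    (huniq : UniqueUkOrbit F N K (k + 1) ν.εreg (gaugeAct v ((avOfRecord F N K k).avg V))) (b : PBond (F.P K) k) :
    GaugeGroup.dist1 ((axialize cd (critCfgOfRecord F N ν K k ((avOfRecord F N K k).avg (gaugeAct (liftTransf v) V))) b)⁻¹ *
        gaugeAct (liftTransf v) V b) =
      GaugeGroup.dist1 ((axialize cd (critCfgOfRecord F N ν K k ((avOfRecord F N K k).avg V)) b)⁻¹ * V b) := by
  rw [avg_gaugeAct_liftTransf hk, axialize_critCfgOfRecord_gaugeAct hk cd v hex huniq]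
  set c := axialize cd (critCfgOfRecord F N ν K k ((avOfRecord F N K k).avg V)) b
  have h : (gaugeAct (liftTransf v) (axialize cd (critCfgOfRecord F N ν K k ((avOfRecord F N K k).avg V))) b)⁻¹ * gaugeAct (liftTransf v) V b =
      liftTransf v b.tgt * (c⁻¹ * V b) * (liftTransf v b.tgt)⁻¹ := by
    simp only [GaugeField.gaugeAct, c, mul_inv_rev, inv_inv]
    group
  rw [h, GaugeGroup.dist1_conj]

end Literature.MathematicalPhysics.QuantumFieldTheory.Balaban1983to89.Node00

end
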